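import Mathlib
import HarnessLib
import Summits.ABC.ABC.Theses.CongruentialReceptacle
import Summits.ABC.ABC.Theorems.CongruentialReceptacleAssembly
import Summits.ABC.ABC.Theorems.CongruentialReceptacleQuarterWindowGivesCrux
import Summits.ABC.ABC.Theorems.CongruentialReceptacleCompactBalanceTransferSplit
import Summits.ABC.ABC.Theorems.CongruentialReceptacleBalancedFreySzpiroPort
import Summits.ABC.ABC.Theorems.CongruentialReceptacleTameLocalReceptacleGivesTarget
import Summits.ABC.ABC.Theorems.CompactBalanceTransfer.Negative.QuarterReduction

/-!
# Crux `CompactBalanceTransfer` (stmt-ABC-1725) is the RESIDUAL of the route Target in the summit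

Route `CongruentialReceptacle` (route-ABC-CongruentialReceptacle). Crux `CompactBalanceTransfer := H → ABC`,
`H := ∀ κ > 0, ∀ ε > 0, ∃ C, ∀ abc-triples, κc ≤ a → κc ≤ b → c < C · rad(abc)^(1+ε)` (abc on every compactly
balanced cell); route Target `BalancedFreySzpiro` (Szpiro `6+ε` in elementary currency on the same cells).

This file is the crux-strategist's (redirect pass r1, seat `planner-cstrat-stmt-ABC-1725-r1-0`, 2026-08-17)
**summit-strength certificate relative to the route**, the theorem asked for by the redirect instruction
("confirm `no-strategy` with the theorem that makes the crux summit-strength, so the tribunal can close it"):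

* `balancedABC_iff_target` — the crux hypothesis `H` IS the route Target (`H ↔ BalancedFreySzpiro`; both
  directions were in the tree in pieces: `balancedABC_of_balancedFreySzpiro`, and quarter-window abc ⟹ quarter
  Szpiro ⟹ Target by `szpiroQuarter_of_quarterBalanced` + `quarterWindowGivesCrux_proof`).
* `compactBalanceTransfer_iff_target_imp_abc` — hence the crux is LITERALLY `Target → ABC`.
* `abc_iff_target_and_compactBalanceTransfer` — **conjunct split**: `ABC ↔ BalancedFreySzpiro ∧ CompactBalanceTransfer`.
  The route's Target and this crux are jointly EQUIVALENT to the summit; the crux is the complement of the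
  Target in `ABC` (D-0033 "CONJUNCT SPLITS": the imported complement is the `residual`).
* `compactBalanceTransfer_iff_abc_of_target`, `…_of_balancedABC`, `…_of_tameLocalReceptacle` — in any world where
  the route's other open crux `TameLocalReceptacle` (rank 2) holds, or its Target holds, or merely `H` holds,
  `CompactBalanceTransfer ↔ ABC`: inside the route's own cone the crux is the summit.
* `compactBalanceTransfer_of_partner` / `compactBalanceTransfer_weakest_partner` — MINIMALITY: every statement
  `R` that can serve as the Target's archimedean partner (`BalancedFreySzpiro → R → ABC`) already implies
  `CompactBalanceTransfer`; the crux is the weakest possible partner, so no re-typing of the partner inside this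
  route can be weaker than it (a weaker-looking partner is either equivalent or does not close the route).

All statements are elementary logic over landed theorems; unconditional; standard axioms; no `def`s, no named
facts. They do NOT show `CompactBalanceTransfer → ABC` (that would need `H` proved): the crux is a strict-looking
consequence of `ABC` with no separating witness on record (STRATEGY-CENSUS r1).
-/

-- `Summit.<Summit>.<Problem>`: for the single-conjunct summit `ABC` the duplicate `ABC.ABC` is mandated.
set_option linter.dupNamespace false

namespace Summit.ABC.ABC.Theorems.CompactBalanceTransfer.Negative

open Literature.NumberTheory.DiophantineGeometry
open Summit.ABC.ABC.Theses.CongruentialReceptacle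

/-! ## §1 The crux hypothesis `H` is the route Target -/

-- `ABC → BalancedFreySzpiro` is the landed `Summit.ABC.ABC.Theorems.balancedFreySzpiro_of_abc`
-- (`CongruentialReceptacleBalancedFreySzpiroPort.lean`), reused below.

/-- **`H ↔ Target`.** abc with exponent `1+ε` on every compactly balanced cell (the crux hypothesis `H`) is
equivalent to Szpiro `6+ε` in elementary currency on every compactly balanced cell (the route Target):
`←` is the currency change `balancedABC_of_balancedFreySzpiro` (`(abc)² ≥ κ⁴c⁶`); `→` specialises `H` to the
quarter cell, changes currency there (`szpiroQuarter_of_quarterBalanced`: `(abc)² ≤ c⁶`) and runs the landed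
squaring descent `quarterWindowGivesCrux_proof`. [folklore] -/
theorem balancedABC_iff_target :
    (∀ κ : ℝ, 0 < κ → ∀ ε : ℝ, 0 < ε → ∃ C : ℝ, ∀ a b c : ℕ, IsABCTriple a b c →
        κ * (c : ℝ) ≤ (a : ℝ) → κ * (c : ℝ) ≤ (b : ℝ) → (c : ℝ) < C * ((rad a b c : ℕ) : ℝ) ^ (1 + ε)) ↔
      BalancedFreySzpiro := by
  constructor
  · intro hH
    exact Summit.ABC.ABC.Theorems.quarterWindowGivesCrux_proof
      (szpiroQuarter_of_quarterBalanced (fun ε hε => hH (1 / 4) (by norm_num) ε hε))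
  · exact Summit.ABC.ABC.Theorems.balancedABC_of_balancedFreySzpiro

/-- **The crux is literally `Target → ABC`.** [folklore] -/
theorem compactBalanceTransfer_iff_target_imp_abc :
    CompactBalanceTransfer ↔ (BalancedFreySzpiro → _root_.ABC) := by
  constructor
  · intro hT hX
    exact hT (Summit.ABC.ABC.Theorems.balancedABC_of_balancedFreySzpiro hX)
  · intro h hH
    exact h (balancedABC_iff_target.mp hH)

/-! ## §2 Conjunct split: the crux is the complement of the Target in the summit -/

/-- **Conjunct split (residual certificate).** `ABC ↔ BalancedFreySzpiro ∧ CompactBalanceTransfer`: the route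
Target and the archimedean-partner crux are JOINTLY EQUIVALENT to the summit (`→`: both are consequences of
`ABC`; `←`: the proved route item `Assembly`, `congruentialReceptacle_assembly_proof`). In the D-0033 vocabulary
the crux is the residual of the Target. [folklore] -/
theorem abc_iff_target_and_compactBalanceTransfer :
    _root_.ABC ↔ (BalancedFreySzpiro ∧ CompactBalanceTransfer) :=
  ⟨fun hA => ⟨Summit.ABC.ABC.Theorems.balancedFreySzpiro_of_abc hA, fun _ => hA⟩,
    fun h => Summit.ABC.ABC.Theorems.congruentialReceptacle_assembly_proof h.1 h.2⟩

/-- Given the Target, the crux IS the summit. [folklore] -/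
theorem compactBalanceTransfer_iff_abc_of_target (hX : BalancedFreySzpiro) :
    CompactBalanceTransfer ↔ _root_.ABC :=
  ⟨fun hT => Summit.ABC.ABC.Theorems.congruentialReceptacle_assembly_proof hX hT,
    fun hA _ => hA⟩

/-- Given its own hypothesis `H`, the crux IS the summit. [folklore] -/
theorem compactBalanceTransfer_iff_abc_of_balancedABC
    (hH : ∀ κ : ℝ, 0 < κ → ∀ ε : ℝ, 0 < ε → ∃ C : ℝ, ∀ a b c : ℕ, IsABCTriple a b c →
        κ * (c : ℝ) ≤ (a : ℝ) → κ * (c : ℝ) ≤ (b : ℝ) → (c : ℝ) < C * ((rad a b c : ℕ) : ℝ) ^ (1 + ε)) :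
    CompactBalanceTransfer ↔ _root_.ABC :=
  ⟨fun hT => hT hH, fun hA _ => hA⟩

/-- **Inside the route's cone the crux is the summit.** If the route's rank-2 crux `TameLocalReceptacle` holds,
then (through the proved glue `TameLocalReceptacleGivesTarget_proof`) the Target holds and
`CompactBalanceTransfer ↔ ABC`. So once the receptacle closes, what remains of the route is `ABC` itself. [folklore] -/
theorem compactBalanceTransfer_iff_abc_of_tameLocalReceptacle (hR : TameLocalReceptacle) :
    CompactBalanceTransfer ↔ _root_.ABC :=
  compactBalanceTransfer_iff_abc_of_target (Summit.ABC.ABC.Theorems.TameLocalReceptacleGivesTarget_proof hR)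

/-! ## §3 Minimality: the crux is the weakest possible archimedean partner of the Target -/

/-- **Every partner implies the crux.** If a statement `R` closes the route together with the Target
(`BalancedFreySzpiro → R → ABC`), then `R → CompactBalanceTransfer`. Hence no re-typing of the archimedean partner
can be strictly weaker than the filed crux: a candidate partner is either equivalent to it (given the Target's
provability is not assumed, equivalent as a partner) or fails to close the route. [folklore] -/
theorem compactBalanceTransfer_of_partner {R : Prop} (h : BalancedFreySzpiro → R → _root_.ABC) (hR : R) :
    CompactBalanceTransfer :=
  compactBalanceTransfer_iff_target_imp_abc.mpr fun hX => h hX hR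

/-- **The crux is a partner and the weakest one** (conjunction of `Assembly` and `compactBalanceTransfer_of_partner`).
[folklore] -/
theorem compactBalanceTransfer_weakest_partner :
    (BalancedFreySzpiro → CompactBalanceTransfer → _root_.ABC) ∧
      ∀ R : Prop, (BalancedFreySzpiro → R → _root_.ABC) → (R → CompactBalanceTransfer) :=
  ⟨Summit.ABC.ABC.Theorems.congruentialReceptacle_assembly_proof,
    fun _ h hR => compactBalanceTransfer_of_partner h hR⟩

/-- **Negative reading for the tribunal.** A refutation of the crux is exactly `Target ∧ ¬ABC`
(equivalently `H ∧ ¬ABC`, `not_compactBalanceTransfer_iff`): it would contain a PROOF of the route Target together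
with a disproof of the summit. [folklore] -/
theorem not_compactBalanceTransfer_iff_target :
    ¬ CompactBalanceTransfer ↔ (BalancedFreySzpiro ∧ ¬ _root_.ABC) := by
  rw [compactBalanceTransfer_iff_target_imp_abc]
  exact Classical.not_imp

end Summit.ABC.ABC.Theorems.CompactBalanceTransfer.Negative
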